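import Summits.QuantumFields.YangMills.Theorems.ParabolicTrajectoryLatticeGapOnTrajectoryStepScalingDefs
import Summits.QuantumFields.YangMills.Theorems.ParabolicTrajectoryLatticeGapOnTrajectorySparseDefectEngineSanity
import Summits.QuantumFields.YangMills.Theorems.LatticeGapOnTrajectory.Negative.Residuals

/-!
# Crux-triage r2 k1 — machine checks for crux stmt-QuantumFields-10523 (`LatticeGapOnTrajectory`)

§A idea `step-scaling-contraction`:
* `anchor_free` — the card's anchor stub `TunedBoxGap` holds for EVERY representation / scheme /
  anchor sides with `(κ, μ) = (4e, 1)` (tree `StepScaling.tunedBoxGap_of_exp_le`, lead c5): θ, `β_k → ∞`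
  and simplicity are not consumed by the anchor (card claim (ii) is void in the typed currency).
* `floor` — the step-scaling variable has the free thermal floor `ζ ≥ 1` at `κ = 4e` for every Wilson
  measure (tree `StepScaling.le_zeta_of_exp_le`): the small-ζ (femto, asymptotically free) end of the
  "law Φ" is invisible below `log(κ/4)` (card claim (iv) "simplicity = no fixed point at small ζ via b₀"
  is void as typed).
* `no_stepLaw_of_convergent_orbit` — NEW (pure real analysis): a convergent positive orbit refutes every
  `StepLaw` minorant. Reading: `UniformStepScaling` along a scheme is exactly the statement that no
  step-scaling orbit `ζ_k(2^j S)` accumulates at a finite value — "no infrared fixed point", i.e. the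
  finite-size form of the mass gap itself (together with the tree's ladder lemma, which gives the
  converse growth `ζ_j ≥ c 2^j`). This is the costume finding of TRIAGE.md.
* `no_stepLaw_of_sublinear_doubling` — NEW: an orbit that eventually grows by a factor `≤ 2 − δ` per
  doubling while tending to infinity also refutes every `StepLaw` (the large-ζ clause `Φ ζ ≥ 2ζ − C`
  excludes every sub-linear infrared scaling, e.g. an interacting IR fixed point approached from below).

§B idea `sparse-defect-orbit-window`:
* `typical_weaker` — the typical-data window package is implied by okfs's sup-form package
  (tree `IsTypicalKRWindow.of_isKRWindow`): the physics conjunct is WEAKER than the r1-passed stub.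
* `engine_stronger` — the sparse-defect engine implies the landed sup-form `KREngine`
  (tree `kREngine_of_sparseDefectEngine`): the new engine is at least crux-line-sized.
* residual (β) of the FILED text is false without the tuning (tree `Negative.volumeGrowth_false_without_tuning`).
-/

open Filter Topology
open Literature.MathematicalPhysics.QuantumLattice Literature.MathematicalPhysics.QuantumFieldTheory
open Summit.QuantumFields.YangMills.Cruxes.LatticeGapOnTrajectory

namespace TriageR2K1

/-! ## §A step-scaling-contraction -/

/-- F1 (lead c5), re-checked: the anchor is free for every scheme. -/
theorem anchor_free {G : Type} [Group G] [TopologicalSpace G] [IsTopologicalGroup G] [CompactSpace G]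
    [MeasurableSpace G] [BorelSpace G] (r : LatticeRep G) (sch : SpeciesScheme (YMSpecies G))
    (D : ℕ → ℕ) : StepScaling.TunedBoxGap r sch D (4 * Real.exp 1) 1 :=
  StepScaling.tunedBoxGap_of_exp_le r sch D one_pos le_rfl le_rfl

/-- F2 floor, re-checked: `1 ≤ ζ` at `κ = 4e` for every continuous representation, every `β`, every `S`. -/
theorem floor {G : Type} [Group G] [TopologicalSpace G] [IsTopologicalGroup G] [CompactSpace G]
    [MeasurableSpace G] [BorelSpace G] {N : ℕ} {ρ : G →* Matrix (Fin N) (Fin N) ℂ}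
    (hρ : Continuous ρ) (β : ℝ) (S : ℕ) : 1 ≤ StepScaling.zeta ρ β S (4 * Real.exp 1) :=
  StepScaling.le_zeta_of_exp_le hρ β S one_pos le_rfl le_rfl

/-- **A convergent positive orbit refutes every step law.** If `ζ_j → z > 0` and `Φ (ζ j) ≤ ζ (j+1)`
for all `j`, continuity of `Φ` gives `Φ z ≤ z`, contradicting `z < Φ z`. -/
theorem no_stepLaw_of_convergent_orbit (law : StepScaling.StepLaw) (ζ : ℕ → ℝ) {z : ℝ} (hz : 0 < z)
    (hconv : Tendsto ζ atTop (𝓝 z)) (hlaw : ∀ j, law.Φ (ζ j) ≤ ζ (j + 1)) : False := by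
  have h1 : Tendsto (fun j => law.Φ (ζ j)) atTop (𝓝 (law.Φ z)) :=
    (law.continuous.tendsto z).comp hconv
  have h2 : Tendsto (fun j => ζ (j + 1)) atTop (𝓝 z) := hconv.comp (tendsto_add_atTop_nat 1)
  have hle : law.Φ z ≤ z := le_of_tendsto_of_tendsto h1 h2 (Eventually.of_forall hlaw)
  exact absurd (law.lt_map z hz) (not_lt.2 hle)

/-- **A bounded monotone positive orbit refutes every step law** (the "interacting IR fixed point
approached from below" scenario: `ζ_j` strictly increasing and bounded). -/
theorem no_stepLaw_of_bounded_monotone_orbit (law : StepScaling.StepLaw) (ζ : ℕ → ℝ) (h0 : 0 < ζ 0)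
    (hmono : Monotone ζ) (hbdd : BddAbove (Set.range ζ)) (hlaw : ∀ j, law.Φ (ζ j) ≤ ζ (j + 1)) :
    False := by
  have hconv : Tendsto ζ atTop (𝓝 (⨆ j, ζ j)) := tendsto_atTop_ciSup hmono hbdd
  have hz : 0 < ⨆ j, ζ j := lt_of_lt_of_le h0 (le_ciSup hbdd 0)
  exact no_stepLaw_of_convergent_orbit law ζ hz hconv hlaw

/-- **Sub-linear doubling refutes every step law.** If an orbit obeying the law tends to `+∞` then it
eventually at least doubles up to the constant `C`: `2 ζ_j − C ≤ ζ_{j+1}`; so an orbit with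
`ζ_{j+1} ≤ (2 − δ) ζ_j` eventually (`δ > 0`) and `ζ_j → ∞` is impossible. -/
theorem no_stepLaw_of_sublinear_doubling (law : StepScaling.StepLaw) (ζ : ℕ → ℝ) {δ : ℝ} (hδ : 0 < δ)
    (hinf : Tendsto ζ atTop atTop) (hsub : ∀ᶠ j in atTop, ζ (j + 1) ≤ (2 - δ) * ζ j)
    (hlaw : ∀ j, law.Φ (ζ j) ≤ ζ (j + 1)) : False := by
  have hbig : ∀ᶠ j in atTop, law.ζ₁ ≤ ζ j ∧ law.C / δ + 1 ≤ ζ j :=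
    (hinf.eventually_ge_atTop law.ζ₁).and (hinf.eventually_ge_atTop (law.C / δ + 1))
  obtain ⟨j, ⟨hj1, hj2⟩, hj3⟩ := (hbig.and hsub).exists
  have hshift : 2 * ζ j - law.C ≤ ζ (j + 1) := (law.two_mul_sub_le (ζ j) hj1).trans (hlaw j)
  have hC : law.C ≤ δ * (ζ j - 1) := by
    have := (div_le_iff₀ hδ).1 (by linarith : law.C / δ ≤ ζ j - 1)
    linarith [this]
  nlinarith

/-- Axiom audit hooks. -/
example : True := trivial

/-! ## §B sparse-defect-orbit-window -/

/-- The typical package is weaker than the sup-form package (tree). -/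
example := @SparseDefectOrbitWindow.IsTypicalKRWindow.of_isKRWindow

/-- The sparse-defect engine is at least as strong as the landed `KREngine` (tree). -/
example : SparseDefectOrbitWindow.SparseDefectEngine → OrbitKantorovichFiniteSize.KREngine :=
  SparseDefectOrbitWindow.kREngine_of_sparseDefectEngine

/-- Residual (β) of the filed text is false without the tuning (tree, p132883). -/
example := @Summit.QuantumFields.YangMills.Theorems.LatticeGapOnTrajectory.Negative.volumeGrowth_false_without_tuning

end TriageR2K1
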